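import Literature.Analysis.FluidPDE.PineauVicolOneSliceVorticity

/-!
# ScalingDefectPeepholeDoorCoreLimit — door S30 «ScalingDefectPeepholeDoor» (nsreg-p1 g24 ROUND-28, `r28/Sketch30.lean`
# 0d39fe46f5f4f14c), plate P3 = LEG C `QuietCoreSliceRegular` (Pineau–Vicol 2026 Thm 1.9 in CORE form), part 1/3:
# the compactness–Liouville step, isolated as a lemma about APPROXIMATE LERAY PROFILES

Plate P3 re-runs the compactness proof of the tree theorem
`Literature.Analysis.FluidPDE.pineauVicol_oneSlice_vorticity_small` (Pineau–Vicol 2026 §9.3 replaced by compactness + Tsai's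
Liouville theorem, `PineauVicolOneSliceVorticity.lean`) with the one-slice hypothesis (1.17) on the SIMILARITY CORE `B(0, L√(−t̄))`
instead of the physical ball `B₁`, `Lₙ → ∞` along the contradiction sequence.  This file isolates the part of that proof which does
not see the solutions at all (its Steps 4–7 and the first half of Step 8), so that the core-form theorem (part 2/3,
`ScalingDefectPeepholeDoorCoreVorticity`) stays under the file-size limit:

* `exists_curl_small_of_approxLerayProfiles` — if `Fₙ : ℝ³ → ℝ³` are `C³` with locally uniform `C³` bounds, obey the Type-I envelope
  `|Fₙ(y)| ≤ C_u/(1+|y|)`, are divergence free on `B̄(0, m+1)` for `n ≥ m`, and solve Leray's profile system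
  `−ΔF + ½F + ½(y·∇)F + (F·∇)F + ∇Q = 0` there up to an error `≤ 1/(n+2)` for some differentiable `Qₙ`, then for every `η > 0` and
  every `θ, R > 0` some `Fₙ` has `∫_{B_{2R}} |curl Fₙ|² ≤ θ²/4`.  Proof = the tree's: a `C²_loc` limit along a subsequence
  (`exists_subseq_tendstoUniformlyOn_of_bounds`), which is divergence free, solves the profile system exactly with a pressure
  recovered as a limit of gradients (`exists_hasGradientAt_of_tendstoUniformlyOn`), is a Leray profile in `L⁴`
  (`memLp_four_of_profile_bound`), hence vanishes by Tsai's theorem (`tsai_selfsimilar_holds`); so `DF_{φ n} → 0` locally uniformly.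

Everything here is plumbing of PROVED tree lemmas; no statement of the door is declared in this file.  Door S30 is a regularity
CRITERION inside a HYPOTHETICAL local Type-I blow-up (item 0056 `NoTypeII` stays OPEN); nothing here bears on NS regularity itself.
-/

noncomputable section

set_option linter.dupNamespace false

namespace Summit.NavierStokesRegularity.NavierStokesRegularity.Theorems.ScalingDefectPeepholeDoor

open MeasureTheory Set Function Filter Metric TopologicalSpace InnerProductSpace
open scoped ENNReal NNReal InnerProductSpace RealInnerProductSpace Laplacian Topology
open Literature.Analysis Literature.Analysis.FluidPDE

-- nested operator types (`ℝ³ →L ℝ³ →L ℝ³`)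
set_option maxSynthPendingDepth 3

set_option maxHeartbeats 1600000 in
/-- **Approximate Leray profiles with Type-I decay have small gradients somewhere along the sequence** (the compactness–Liouville
step of `pineauVicol_oneSlice_vorticity_small`, Steps 4–8, isolated): `C³` fields `Fₙ` with locally uniform `C³` bounds
(`‖DᵏFₙ‖ ≤ K_max` on `B̄(0,m+1)` for `n ≥ m`, `k ≤ 3`), the envelope `|Fₙ(y)| ≤ C_u/(1+|y|)`, `div Fₙ = 0` and
`‖−ΔFₙ + ½Fₙ + ½DFₙ(y)[y] + DFₙ(y)[Fₙ(y)] + ∇Qₙ‖ ≤ 1/(n+2)` on `B̄(0,m+1)` for `n ≥ m`: for every `θ > 0`, `R > 0` some `Fₙ` has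
`∫_{B(0,2R)} |curl Fₙ|² ≤ θ²/4` — because every `C²_loc` subsequential limit is a Leray profile (`IsLerayProfile 1 ½`) in `L⁴(ℝ³)`,
which vanishes by Tsai's Liouville theorem [Tsai 1998, Thm 1; tree `tsai_selfsimilar_holds`], so the gradients (hence the curls,
`norm_curl_le`) tend to `0` locally uniformly along the subsequence.  [cite: PineauVicol2026, §9.3 (9.20)–(9.23), arXiv:2607.09619 pp. 52–53 — compactness variant as
in the tree file `PineauVicolOneSliceVorticity`] -/
theorem exists_curl_small_of_approxLerayProfiles {Cu Kmax : ℝ} (hCu : 0 < Cu)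
    (F : ℕ → EuclideanSpace ℝ (Fin 3) → EuclideanSpace ℝ (Fin 3)) (Qf : ℕ → EuclideanSpace ℝ (Fin 3) → ℝ)
    (hF3 : ∀ n, ContDiff ℝ 3 (F n)) (hQd : ∀ n, Differentiable ℝ (Qf n))
    (hbB : ∀ m n : ℕ, m ≤ n → ∀ y ∈ closedBall (0 : EuclideanSpace ℝ (Fin 3)) ((m : ℝ) + 1),
      ‖F n y‖ ≤ Kmax ∧ ‖fderiv ℝ (F n) y‖ ≤ Kmax ∧ ‖fderiv ℝ (fderiv ℝ (F n)) y‖ ≤ Kmax ∧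
        ‖fderiv ℝ (fderiv ℝ (fderiv ℝ (F n))) y‖ ≤ Kmax)
    (hFI : ∀ n y, ‖F n y‖ ≤ Cu / (1 + ‖y‖))
    (hdiv0 : ∀ m n : ℕ, m ≤ n → ∀ y ∈ closedBall (0 : EuclideanSpace ℝ (Fin 3)) ((m : ℝ) + 1),
      VectorCalculus.divergence (F n) y = 0)
    (hEq : ∀ m n : ℕ, m ≤ n → ∀ y ∈ closedBall (0 : EuclideanSpace ℝ (Fin 3)) ((m : ℝ) + 1),
      ‖-((Δ (F n)) y) + (1 / 2 : ℝ) • F n y + (1 / 2 : ℝ) • fderiv ℝ (F n) y y + convect (F n) (F n) y +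
          gradient (Qf n) y‖ ≤ 1 / ((n : ℝ) + 2)) :
    ∀ θ : ℝ, 0 < θ → ∀ R : ℝ, 0 < R → ∃ n : ℕ,
      ∫⁻ y in ball (0 : EuclideanSpace ℝ (Fin 3)) (2 * R), ENNReal.ofReal (‖curl (F n) y‖ ^ 2) ≤
        ENNReal.ofReal (θ ^ 2 / 4) := by
  intro θ hθ R hR0
  /- Step 4: extraction of a `C²_loc` limit. -/
  obtain ⟨φ, hφ, G, G₁, G₂, hlim⟩ :=
    exists_subseq_tendstoUniformlyOn_of_bounds F hF3 fun m => ⟨m, Kmax, hbB m⟩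
  obtain ⟨hGd, hG₁d, hG₂c, hG2⟩ :=
    hasFDerivAt_limits_of_tendstoUniformlyOn (fun n => F (φ n)) (fun n => hF3 (φ n)) hlim
  have hφle : ∀ n, n ≤ φ n := fun n => hφ.id_le n
  have hfG : fderiv ℝ G = G₁ := funext fun y => (hGd y).fderiv
  have hfG₁ : fderiv ℝ G₁ = G₂ := funext fun y => (hG₁d y).fderiv
  have hGc : Continuous G := hG2.continuous
  have hG₁c : Continuous G₁ := continuous_iff_continuousAt.2 fun y => (hG₁d y).continuousAt
  have hmem : ∀ y : EuclideanSpace ℝ (Fin 3), ∃ m : ℕ,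
      y ∈ closedBall (0 : EuclideanSpace ℝ (Fin 3)) ((m : ℝ) + 1) := fun y => by
    obtain ⟨m, hm⟩ := exists_nat_ge ‖y‖
    exact ⟨m, mem_closedBall_zero_iff.2 (by linarith)⟩
  -- Type I bound of the limit
  have hGI : ∀ y, ‖G y‖ ≤ Cu / (1 + ‖y‖) := fun y => by
    obtain ⟨m, hy⟩ := hmem y
    exact le_of_tendsto ((hlim m).1.tendsto_at hy).norm (Eventually.of_forall fun n => hFI (φ n) y)
  -- bounds of the limits of the derivatives
  have hevB : ∀ m : ℕ, ∀ᶠ n in atTop, ∀ y ∈ closedBall (0 : EuclideanSpace ℝ (Fin 3)) ((m : ℝ) + 1),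
      ‖F (φ n) y‖ ≤ Kmax ∧ ‖fderiv ℝ (F (φ n)) y‖ ≤ Kmax ∧
        ‖fderiv ℝ (fderiv ℝ (F (φ n))) y‖ ≤ Kmax ∧
        ‖fderiv ℝ (fderiv ℝ (fderiv ℝ (F (φ n)))) y‖ ≤ Kmax := fun m =>
    (eventually_ge_atTop m).mono fun n hn y hy => hbB m (φ n) (hn.trans (hφle n)) y hy
  have hBG₁ : ∀ m : ℕ, ∀ y ∈ closedBall (0 : EuclideanSpace ℝ (Fin 3)) ((m : ℝ) + 1), ‖G₁ y‖ ≤ Kmax :=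
    fun m => norm_le_of_tendstoUniformlyOn (hlim m).2.1 ((hevB m).mono fun n hn y hy => (hn y hy).2.1)
  /- Step 5: the limit is divergence free. -/
  have hdiv : ∀ y, VectorCalculus.divergence G y = 0 := fun y => by
    obtain ⟨m, hy⟩ := hmem y
    have ht : Tendsto (fun n => fderiv ℝ (F (φ n)) y) atTop (𝓝 (G₁ y)) := (hlim m).2.1.tendsto_at hy
    have h1 := (continuous_trace_clm.tendsto _).comp ht
    have h0 : ∀ᶠ n in atTop, LinearMap.trace ℝ (EuclideanSpace ℝ (Fin 3))
        (fderiv ℝ (F (φ n)) y : EuclideanSpace ℝ (Fin 3) →ₗ[ℝ] EuclideanSpace ℝ (Fin 3)) = 0 :=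
      (eventually_ge_atTop m).mono fun n hn => hdiv0 m (φ n) (hn.trans (hφle n)) y hy
    have h2 : Tendsto (fun n => LinearMap.trace ℝ (EuclideanSpace ℝ (Fin 3))
        (fderiv ℝ (F (φ n)) y : EuclideanSpace ℝ (Fin 3) →ₗ[ℝ] EuclideanSpace ℝ (Fin 3)))
        atTop (𝓝 0) :=
      tendsto_const_nhds.congr' (h0.mono fun n hn => hn.symm)
    unfold VectorCalculus.divergence
    rw [hfG]
    exact tendsto_nhds_unique h1 h2
  /- Step 6: the profile equation in the limit. -/
  obtain ⟨Er, hEr⟩ : ∃ Er : ℕ → EuclideanSpace ℝ (Fin 3) → EuclideanSpace ℝ (Fin 3), ∀ n y,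
      Er n y = -((Δ (F n)) y) + (1 / 2 : ℝ) • F n y + (1 / 2 : ℝ) • fderiv ℝ (F n) y y + convect (F n) (F n) y +
        gradient (Qf n) y := ⟨_, fun _ _ => rfl⟩
  have hEr_le : ∀ m n : ℕ, m ≤ n → ∀ y ∈ closedBall (0 : EuclideanSpace ℝ (Fin 3)) ((m : ℝ) + 1),
      ‖Er n y‖ ≤ 1 / ((n : ℝ) + 2) := fun m n hmn y hy => by
    rw [hEr]
    exact hEq m n hmn y hy
  -- the standard basis and the Laplacians
  set e : Fin 3 → EuclideanSpace ℝ (Fin 3) := fun i => EuclideanSpace.basisFun (Fin 3) ℝ i with he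
  have hLapF : ∀ n y, (Δ (F n)) y = ∑ i, fderiv ℝ (fderiv ℝ (F n)) y (e i) (e i) := fun n y =>
    laplacian_apply_eq_sum_fderiv_fderiv_basisFun _ _
  have hLapG : ∀ y, (Δ G) y = ∑ i, G₂ y (e i) (e i) := fun y => by
    rw [laplacian_apply_eq_sum_fderiv_fderiv_basisFun, hfG, hfG₁]
  -- the pressure gradient of the cut-off profiles in terms of the converging quantities
  have hWeq : ∀ m n : ℕ, m ≤ n → ∀ y ∈ closedBall (0 : EuclideanSpace ℝ (Fin 3)) ((m : ℝ) + 1),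
      gradient (Qf n) y = Er n y + (∑ i, fderiv ℝ (fderiv ℝ (F n)) y (e i) (e i))
        - (1 / 2 : ℝ) • F n y - (1 / 2 : ℝ) • fderiv ℝ (F n) y y - fderiv ℝ (F n) y (F n y) := by
    intro m n _hmn y _hy
    rw [hEr n y, hLapF n y]
    unfold convect
    abel
  -- the limit `W'` of the pressure gradients
  obtain ⟨W', hW'def⟩ : ∃ W' : EuclideanSpace ℝ (Fin 3) → EuclideanSpace ℝ (Fin 3), ∀ y,
      W' y = (∑ i, G₂ y (e i) (e i)) - (1 / 2 : ℝ) • G y - (1 / 2 : ℝ) • G₁ y y - G₁ y (G y) :=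
    ⟨_, fun _ => rfl⟩
  have hW'c : Continuous W' := by
    have e1 : W' = fun y => (∑ i, G₂ y (e i) (e i)) - (1 / 2 : ℝ) • G y - (1 / 2 : ℝ) • G₁ y y
        - G₁ y (G y) := funext hW'def
    rw [e1]
    have hs : Continuous fun y => ∑ i, G₂ y (e i) (e i) :=
      continuous_finsetSum _ fun i _ => (hG₂c.clm_apply continuous_const).clm_apply continuous_const
    have c1 : Continuous fun y => (1 / 2 : ℝ) • G y := hGc.const_smul (1 / 2 : ℝ)
    have c2 : Continuous fun y => (1 / 2 : ℝ) • G₁ y y :=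
      (hG₁c.clm_apply continuous_id).const_smul (1 / 2 : ℝ)
    have c3 : Continuous fun y => G₁ y (G y) := hG₁c.clm_apply hGc
    exact ((hs.sub c1).sub c2).sub c3
  have hWφ : ∀ m : ℕ, TendstoUniformlyOn (fun n y => gradient (Qf (φ n)) y) W' atTop
      (closedBall (0 : EuclideanSpace ℝ (Fin 3)) ((m : ℝ) + 1)) := by
    intro m
    set s : Set (EuclideanSpace ℝ (Fin 3)) := closedBall 0 ((m : ℝ) + 1) with hs_def
    have hT0 : TendstoUniformlyOn (fun n => F (φ n)) G atTop s := (hlim m).1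
    have hT1g : TendstoUniformlyOn (fun n => fderiv ℝ (F (φ n))) G₁ atTop s := (hlim m).2.1
    have hT2g : TendstoUniformlyOn (fun n => fderiv ℝ (fderiv ℝ (F (φ n)))) G₂ atTop s :=
      (hlim m).2.2
    -- the error tends to zero uniformly
    have hE : TendstoUniformlyOn (fun n y => Er (φ n) y) (fun _ => (0 : EuclideanSpace ℝ (Fin 3)))
        atTop s := by
      rw [Metric.tendstoUniformlyOn_iff]
      intro ε hε
      obtain ⟨N, hN⟩ := exists_nat_gt (1 / ε)
      filter_upwards [eventually_ge_atTop (max N m)] with n hn y hy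
      have hnm : m ≤ n := (le_max_right _ _).trans hn
      have hnN : N ≤ n := (le_max_left _ _).trans hn
      rw [dist_comm, dist_zero_right]
      refine (hEr_le m (φ n) (hnm.trans (hφle n)) y hy).trans_lt ?_
      have h1 : (N : ℝ) ≤ φ n := by exact_mod_cast hnN.trans (hφle n)
      have h2 : 1 / ε < (φ n : ℝ) + 2 := by linarith
      rw [one_div_lt hε (by positivity)] at h2
      exact h2
    -- the Laplacians converge uniformly
    have hLap : TendstoUniformlyOn (fun n y => ∑ i, fderiv ℝ (fderiv ℝ (F (φ n))) y (e i) (e i))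
        (fun y => ∑ i, G₂ y (e i) (e i)) atTop s := by
      have hi : ∀ i, TendstoUniformlyOn (fun n y => fderiv ℝ (fderiv ℝ (F (φ n))) y (e i) (e i))
          (fun y => G₂ y (e i) (e i)) atTop s := fun i =>
        tendstoUniformlyOn_clm_apply_const (tendstoUniformlyOn_clm_apply_const hT2g (e i)) (e i)
      simp only [Fin.sum_univ_three]
      exact ((hi 0).add (hi 1)).add (hi 2)
    -- `DFₙ(y)[y]` and `DFₙ(y)[Fₙ(y)]`
    have hT1 : TendstoUniformlyOn (fun n y => fderiv ℝ (F (φ n)) y y) (fun y => G₁ y y) atTop s :=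
      tendstoUniformlyOn_clm_apply_of_bound hT1g
        (tendstoUniformlyOn_const_seq (fun y : EuclideanSpace ℝ (Fin 3) => y) s)
        (B₁ := (m : ℝ) + 1) (Eventually.of_forall fun n y hy => mem_closedBall_zero_iff.1 hy)
        (hBG₁ m)
    have hT2 : TendstoUniformlyOn (fun n y => fderiv ℝ (F (φ n)) y (F (φ n) y))
        (fun y => G₁ y (G y)) atTop s :=
      tendstoUniformlyOn_clm_apply_of_bound hT1g hT0 (B₁ := Cu)
        (Eventually.of_forall fun n y _ =>
          (hFI (φ n) y).trans (div_le_self hCu.le (by linarith [norm_nonneg y])))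
        (hBG₁ m)
    have hH0 : TendstoUniformlyOn (fun n y => (1 / 2 : ℝ) • F (φ n) y)
        (fun y => (1 / 2 : ℝ) • G y) atTop s :=
      (uniformContinuous_const_smul (1 / 2 : ℝ)).comp_tendstoUniformlyOn hT0
    have hH1 : TendstoUniformlyOn (fun n y => (1 / 2 : ℝ) • fderiv ℝ (F (φ n)) y y)
        (fun y => (1 / 2 : ℝ) • G₁ y y) atTop s :=
      (uniformContinuous_const_smul (1 / 2 : ℝ)).comp_tendstoUniformlyOn hT1
    have hX : TendstoUniformlyOn
        (fun n y => Er (φ n) y + (∑ i, fderiv ℝ (fderiv ℝ (F (φ n))) y (e i) (e i))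
          - (1 / 2 : ℝ) • F (φ n) y - (1 / 2 : ℝ) • fderiv ℝ (F (φ n)) y y
          - fderiv ℝ (F (φ n)) y (F (φ n) y))
        (fun y => 0 + (∑ i, G₂ y (e i) (e i)) - (1 / 2 : ℝ) • G y - (1 / 2 : ℝ) • G₁ y y
          - G₁ y (G y)) atTop s :=
      (((hE.add hLap).sub hH0).sub hH1).sub hT2
    refine (hX.congr ?_).congr_right ?_
    · filter_upwards [eventually_ge_atTop m] with n hn y hy
      exact (hWeq m (φ n) (hn.trans (hφle n)) y hy).symm
    · intro y _
      dsimp only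
      rw [hW'def, zero_add]
  obtain ⟨P, hPg⟩ := exists_hasGradientAt_of_tendstoUniformlyOn
    (Q := fun n => Qf (φ n)) (W := fun n y => gradient (Qf (φ n)) y)
    (fun n y => ((hQd (φ n)) y).hasGradientAt) hWφ
  /- Step 7: the limit is a Leray profile in `L⁴`, hence zero. -/
  have hprof : IsLerayProfile 1 (1 / 2) G P :=
    { contDiff_velocity := hG2
      contDiff_pressure := contDiff_one_of_hasGradientAt hPg hW'c
      profile_eq := fun y => by
        rw [one_smul, hLapG y, (hPg y).gradient, hW'def]
        simp only [convect, hfG]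
        abel
      divFree := hdiv }
  have hL4 : MemLp G 4 volume :=
    memLp_four_of_profile_bound hGc (C₀ := Cu) fun y => by rw [add_comm]; exact hGI y
  have hT := @tsai_selfsimilar_holds
  have hG0 : G = 0 :=
    hT (ν := 1) (a := 1 / 2) one_pos (by norm_num) hprof (q := 4) (by norm_num) (by simp) hL4
  /- Step 8 (first half): the gradients of the subsequence are eventually small. -/
  have hG₁0 : ∀ y, G₁ y = 0 := fun y => by
    have h0 : (0 : EuclideanSpace ℝ (Fin 3) → EuclideanSpace ℝ (Fin 3)) =
        fun _ => (0 : EuclideanSpace ℝ (Fin 3)) := rfl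
    rw [← hfG, hG0, h0, fderiv_const_apply]
  set M : ℕ := ⌈2 * R⌉₊ with hM
  have hMR : 2 * R ≤ (M : ℝ) := by rw [hM]; exact Nat.le_ceil _
  have hballM : ball (0 : EuclideanSpace ℝ (Fin 3)) (2 * R) ⊆ closedBall 0 ((M : ℝ) + 1) := by
    intro y hy
    rw [mem_ball_zero_iff] at hy
    exact mem_closedBall_zero_iff.2 (by linarith)
  -- the volume of `B(0, 2R)` and the size of the curl map
  set κ : ℝ := ‖curlCLM‖ with hκ
  set v : ℝ := (volume (ball (0 : EuclideanSpace ℝ (Fin 3)) (2 * R))).toReal with hv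
  have hvfin : volume (ball (0 : EuclideanSpace ℝ (Fin 3)) (2 * R)) < ⊤ := measure_ball_lt_top
  have hv0 : 0 ≤ v := ENNReal.toReal_nonneg
  have hκ0 : 0 ≤ κ := norm_nonneg _
  set η : ℝ := min 1 (θ ^ 2 / (4 * ((κ ^ 2 + 1) * (v + 1)))) with hη
  have hη0 : 0 < η := lt_min one_pos (by positivity)
  have hη1 : η ≤ 1 := min_le_left _ _
  have hη2 : η ≤ θ ^ 2 / (4 * ((κ ^ 2 + 1) * (v + 1))) := min_le_right _ _
  have hkey : κ ^ 2 * η ^ 2 * v ≤ θ ^ 2 / 4 := by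
    have h1 : κ ^ 2 * v ≤ (κ ^ 2 + 1) * (v + 1) := by nlinarith
    calc κ ^ 2 * η ^ 2 * v = (κ ^ 2 * v * η) * η := by ring
      _ ≤ (κ ^ 2 * v * η) * 1 := mul_le_mul_of_nonneg_left hη1 (by positivity)
      _ ≤ ((κ ^ 2 + 1) * (v + 1)) * η := by
          rw [mul_one]; exact mul_le_mul_of_nonneg_right h1 hη0.le
      _ ≤ ((κ ^ 2 + 1) * (v + 1)) * (θ ^ 2 / (4 * ((κ ^ 2 + 1) * (v + 1)))) := by gcongr
      _ = θ ^ 2 / 4 := by field_simp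
  -- eventually the gradients are `η`-small on `B̄(0, M+1)`
  have hsmall : ∀ᶠ n in atTop, ∀ y ∈ closedBall (0 : EuclideanSpace ℝ (Fin 3)) ((M : ℝ) + 1),
      ‖fderiv ℝ (F (φ n)) y‖ < η := by
    have h := (Metric.tendstoUniformlyOn_iff.1 (hlim M).2.1) η hη0
    filter_upwards [h] with n hn y hy
    have := hn y hy
    rwa [hG₁0 y, dist_comm, dist_zero_right] at this
  obtain ⟨n, hn⟩ := hsmall.exists
  -- the gradients, hence the curls, are small on `B(0, 2R)`
  refine ⟨φ n, ?_⟩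
  calc ∫⁻ y in ball (0 : EuclideanSpace ℝ (Fin 3)) (2 * R), ENNReal.ofReal (‖curl (F (φ n)) y‖ ^ 2)
      ≤ ∫⁻ y in ball (0 : EuclideanSpace ℝ (Fin 3)) (2 * R), ENNReal.ofReal (κ ^ 2 * η ^ 2) := by
        refine setLIntegral_mono' measurableSet_ball fun y hy => ENNReal.ofReal_le_ofReal ?_
        have h1 : ‖curl (F (φ n)) y‖ ≤ κ * η :=
          (norm_curl_le _ _).trans (mul_le_mul_of_nonneg_left (hn y (hballM hy)).le hκ0)
        calc ‖curl (F (φ n)) y‖ ^ 2 ≤ (κ * η) ^ 2 := pow_le_pow_left₀ (norm_nonneg _) h1 2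
          _ = κ ^ 2 * η ^ 2 := by ring
    _ = ENNReal.ofReal (κ ^ 2 * η ^ 2) * volume (ball (0 : EuclideanSpace ℝ (Fin 3)) (2 * R)) :=
        setLIntegral_const _ _
    _ = ENNReal.ofReal (κ ^ 2 * η ^ 2 * v) := by
        rw [hv, ENNReal.ofReal_mul (p := κ ^ 2 * η ^ 2) (by positivity),
          ENNReal.ofReal_toReal hvfin.ne]
    _ ≤ ENNReal.ofReal (θ ^ 2 / 4) := ENNReal.ofReal_le_ofReal hkey

end Summit.NavierStokesRegularity.NavierStokesRegularity.Theorems.ScalingDefectPeepholeDoor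

end
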